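/- Copyright: the b2b-balaban cell (near-miss cell 7), T⁴-continuum fan-out, NE7b swarm leaf 04 (gen 7; row S12o
«CONCAVE ENTROPY REPAIR», part (i-a): the pure-Mathlib concave cores — owner's division R-OWNER-23-15 (2) refined,
journal l.17944).  Released under the licence of the surrounding project. -/
import Mathlib

/-!
# Row S12o, part (i-a): THE CONCAVE CORES — Jensen for `log` on a finset, the padding monotonicity, the tangent line at a pivot

Summits-side support leaf of the T⁴-continuum cell (rung (B)+1 on a FINITE torus only; NOT infinite volume, NOT the
mass gap, NOT the Clay statement; NOT a proof of the spine estimate NE7b).  Row NE7b, NEW ROW S12o «CONCAVE ENTROPY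
REPAIR» of the owner's ruling R-OWNER-23-15 (findings F-leaf10g12-1 + F-leaf08g11-1: the constant `Θ ≈ 10²⁷` of the COUNT
road's `hθJ` is two PROOF-class POINTWISE LINEARISATIONS — `(2⌊r⌋+1)^d ≤ e^{2dr}` and `n·log(Q∕n) ≤ Q − n` — of sums of
LOGS of class-linear quantities; their concave (Jensen ∕ tangent-line) forms give `Θ_honest ≈ 875`).  This file is part
(i-a) of the owner's division of labour (l.17944): the PURE-MATHLIB cores everyone else imports BY NAME — (i-b) the pivot
step in the sibling-entropy letters (leaf-09 g9), (i-c)∕(ii) the distance-potential twin and the twin END (leaf-10 g12),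
(iii)∕(v) instance∕junction siblings and numerals (leaf-08 g11), (iv) optional pinned∕headline (leaf-02 lineage).
[folklore] real analysis (`Mathlib` only: `strictConcaveOn_log_Ioi`, `ConcaveOn.le_map_sum`, `Real.log_le_sub_one_of_pos`);
no `def`, no `structure`, no `[cite:]` tag, no `Prop`-valued definition (c1), no constant of print (c2∕c6), no exit ∕
socket ∕ `HistoryConstants` file touched (c3); nothing printed asserted.

WHAT.
* **`sum_log_le_card_mul_log_div`** — JENSEN for `log` on a nonempty finset: `∑ log x_i ≤ #s · log((∑ x_i) ∕ #s)`.
* **`mul_log_one_add_div_le`** — PADDING: `n ↦ n·log(1 + S∕n)` is monotone (`0 < n ≤ F`, `0 ≤ S`).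
* **`sum_log_one_add_two_mul_le`** — THE CONCAVE RADIUS BOUND: `r_i ≥ 0`, `#s ≤ F`, `0 < F`, `∑ r_i ≤ R·F` ⇒
  `∑ log(1 + 2r_i) ≤ F·log(1 + 2R)` (in place of the linear `∑ 2r_i ≤ 2R·F` inside an exponential); product form
  **`prod_one_add_two_mul_pow_le_exp`**: `∏ (1 + 2r_i)^d ≤ exp(d·F·log(1 + 2R))`.
* **`mul_log_div_le_pivot`** — THE TANGENT LINE AT A PIVOT `W`: `n·log(Q∕n) ≤ n·log W + Q∕W − n` (in place of
  `n·log(Q∕n) ≤ Q − n`, the pivot `W = 1`).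

HONEST SCOPE.  Inequalities of real analysis; they change no statement of the COUNT road by themselves (the headline
of record p224237 is unchanged by S12o — only the size of the hidden `g₁` moves once (ii)–(iii) land); nothing of H3 ∕
(B) ∕ BetaPertH or of the nine spine estimates is discharged; NE7b NOT proved; spine 0∕9.  HONEST DEPENDENCY (cell):
continuum YM on T⁴ ⇐ BetaPertH ∧ nine spine estimates (0/9 proved); BetaPertH ⇐ (D1) ∧ (D4) ∧ CAP+tail; G-an2-4 gates
asym, D1 and NE2/3/4.  This file changes none of it. -/

open Finset Real

namespace Summit.QuantumFields.BalabanUV.T4Continuum.HistoryConcaveJensen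

/-- **JENSEN FOR `log` ON A FINSET**: `∑ log x_i ≤ #s · log((∑ x_i) ∕ #s)` for positive `x_i` on a nonempty `s`. [folklore] -/
theorem sum_log_le_card_mul_log_div {ι : Type*} (s : Finset ι) (hs : s.Nonempty) (x : ι → ℝ)
    (hx : ∀ i ∈ s, 0 < x i) :
    ∑ i ∈ s, Real.log (x i) ≤ (#s : ℝ) * Real.log ((∑ i ∈ s, x i) / #s) := by
  have hn : (0 : ℝ) < #s := by exact_mod_cast hs.card_pos
  have hJ := (strictConcaveOn_log_Ioi.concaveOn).le_map_sum (t := s) (w := fun _ => (#s : ℝ)⁻¹) (p := x)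
    (fun _ _ => by positivity) (by rw [sum_const, nsmul_eq_mul, mul_inv_cancel₀ hn.ne']) (fun i hi => hx i hi)
  simp only [smul_eq_mul] at hJ
  rw [← mul_sum, ← mul_sum] at hJ
  have := mul_le_mul_of_nonneg_left hJ hn.le
  rw [← mul_assoc, mul_inv_cancel₀ hn.ne', one_mul] at this
  rw [div_eq_inv_mul]
  exact this

/-- **PADDING**: `n ↦ n·log(1 + S∕n)` is monotone: for `0 < n ≤ F` and `0 ≤ S`, `n·log(1 + S∕n) ≤ F·log(1 + S∕F)`
(concavity of `log` between the points `1 + S∕n` and `1`, weights `n∕F` and `1 − n∕F`). [folklore] -/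
theorem mul_log_one_add_div_le {n F S : ℝ} (hn : 0 < n) (hnF : n ≤ F) (hS : 0 ≤ S) :
    n * Real.log (1 + S / n) ≤ F * Real.log (1 + S / F) := by
  have hF : 0 < F := hn.trans_le hnF
  have hw : 0 ≤ n / F := by positivity
  have hw1 : n / F ≤ 1 := (div_le_one hF).2 hnF
  -- two-point concavity: (n/F)·log(1+S/n) + (1 − n/F)·log 1 ≤ log((n/F)(1+S/n) + (1−n/F)·1) = log(1 + S/F)
  have h2 := (strictConcaveOn_log_Ioi.concaveOn).2 (x := 1 + S / n) (y := (1 : ℝ))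
    (Set.mem_Ioi.2 (by positivity)) (Set.mem_Ioi.2 one_pos) hw (sub_nonneg.2 hw1) (add_sub_cancel (n / F) 1)
  simp only [smul_eq_mul, Real.log_one, mul_zero, add_zero, mul_one] at h2
  have e : n / F * (1 + S / n) + (1 - n / F) = 1 + S / F := by
    field_simp
    ring
  rw [e] at h2
  have := mul_le_mul_of_nonneg_left h2 hF.le
  calc n * Real.log (1 + S / n) = F * (n / F * Real.log (1 + S / n)) := by field_simp
    _ ≤ F * Real.log (1 + S / F) := this

/-- **THE CONCAVE RADIUS BOUND**: `r_i ≥ 0`, `#s ≤ F`, `0 < F`, `∑ r_i ≤ R·F` ⇒ `∑ log(1 + 2 r_i) ≤ F·log(1 + 2R)`. [folklore] -/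
theorem sum_log_one_add_two_mul_le {ι : Type*} (s : Finset ι) (r : ι → ℝ) (hr : ∀ i ∈ s, 0 ≤ r i) {F R : ℝ}
    (hF : 0 < F) (hsF : (#s : ℝ) ≤ F) (hR : ∑ i ∈ s, r i ≤ R * F) :
    ∑ i ∈ s, Real.log (1 + 2 * r i) ≤ F * Real.log (1 + 2 * R) := by
  have hR0 : 0 ≤ R := by
    have : 0 ≤ R * F := (sum_nonneg hr).trans hR
    nlinarith
  rcases s.eq_empty_or_nonempty with rfl | hs
  · simp only [sum_empty]
    exact mul_nonneg hF.le (Real.log_nonneg (by linarith))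
  have hn : (0 : ℝ) < #s := by exact_mod_cast hs.card_pos
  set S := ∑ i ∈ s, r i with hSdef
  have hS : 0 ≤ S := sum_nonneg hr
  -- Jensen
  have h1 := sum_log_le_card_mul_log_div s hs (fun i => 1 + 2 * r i) (fun i hi => by linarith [hr i hi])
  have e1 : (∑ i ∈ s, (1 + 2 * r i)) / #s = 1 + (2 * S) / #s := by
    rw [sum_add_distrib, sum_const, nsmul_eq_mul, mul_one, ← mul_sum, ← hSdef]
    field_simp
  rw [e1] at h1
  -- padding `#s ↦ F`
  have h2 := mul_log_one_add_div_le (S := 2 * S) hn hsF (by positivity)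
  -- monotonicity in `R`
  have h3 : Real.log (1 + 2 * S / F) ≤ Real.log (1 + 2 * R) := by
    apply Real.log_le_log (by positivity)
    have : 2 * S / F ≤ 2 * R := by
      rw [div_le_iff₀ hF]; linarith
    linarith
  calc ∑ i ∈ s, Real.log (1 + 2 * r i) ≤ (#s : ℝ) * Real.log (1 + 2 * S / #s) := h1
    _ ≤ F * Real.log (1 + 2 * S / F) := h2
    _ ≤ F * Real.log (1 + 2 * R) := mul_le_mul_of_nonneg_left h3 hF.le

/-- **PRODUCT FORM**: `∏ (1 + 2 r_i)^d ≤ exp(d·F·log(1 + 2R))` under the same hypotheses. [folklore] -/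
theorem prod_one_add_two_mul_pow_le_exp {ι : Type*} (s : Finset ι) (r : ι → ℝ) (hr : ∀ i ∈ s, 0 ≤ r i) (d : ℕ)
    {F R : ℝ} (hF : 0 < F) (hsF : (#s : ℝ) ≤ F) (hR : ∑ i ∈ s, r i ≤ R * F) :
    ∏ i ∈ s, (1 + 2 * r i) ^ d ≤ Real.exp ((d : ℝ) * (F * Real.log (1 + 2 * R))) := by
  have hpos : ∀ i ∈ s, 0 < 1 + 2 * r i := fun i hi => by linarith [hr i hi]
  have e : ∏ i ∈ s, (1 + 2 * r i) ^ d = Real.exp ((d : ℝ) * ∑ i ∈ s, Real.log (1 + 2 * r i)) := by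
    rw [mul_sum, Real.exp_sum]
    refine prod_congr rfl fun i hi => ?_
    rw [← Real.log_pow, Real.exp_log (pow_pos (hpos i hi) d)]
  rw [e, Real.exp_le_exp]
  exact mul_le_mul_of_nonneg_left (sum_log_one_add_two_mul_le s r hr hF hsF hR) (Nat.cast_nonneg d)

/-- **THE TANGENT LINE AT THE PIVOT `W`**: `n·log(Q∕n) ≤ n·log W + Q∕W − n` for `n, Q, W > 0`
(`log x ≤ x − 1` at `x := Q∕(n·W)`). [folklore] -/
theorem mul_log_div_le_pivot {n Q W : ℝ} (hn : 0 < n) (hQ : 0 < Q) (hW : 0 < W) :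
    n * Real.log (Q / n) ≤ n * Real.log W + Q / W - n := by
  have hx : 0 < Q / (n * W) := by positivity
  have h := Real.log_le_sub_one_of_pos hx
  have e : Real.log (Q / (n * W)) = Real.log (Q / n) - Real.log W := by
    rw [Real.log_div hQ.ne' (by positivity), Real.log_div hQ.ne' hn.ne', Real.log_mul hn.ne' hW.ne']
    ring
  rw [e] at h
  have h' := mul_le_mul_of_nonneg_left h hn.le
  have e2 : n * (Q / (n * W) - 1) = Q / W - n := by field_simp
  rw [e2, mul_sub] at h'
  linarith

end Summit.QuantumFields.BalabanUV.T4Continuum.HistoryConcaveJensen
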